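import Literature.Topology.FourManifolds.LefschetzHandlebody
import Literature.Topology.FourManifolds.SmoothOrientation
import Literature.GroupTheory.CombinatorialGroupTheory.SignedHurwitzStabilisation
import Literature.AlgebraicTopology.SingularHomology.SingularChains
import Mathlib.Topology.Homotopy.Equiv
import HarnessLib

/-!
# Named facts on one-sided Lefschetz models: existence (Etnyre–Fuller), the counts of a
# homotopy 4-sphere, invariance under the signed Hurwitz / stabilisation calculus, and the
# homology of Lefschetz handlebodies

Topic `Literature/Topology/FourManifolds`; namespace `Literature.Topology.FourManifolds.LefschetzBase`.
Four NAMED FACTS (D-0014; `def … : Prop`, nothing proved here) over the vocabulary of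
`LefschetzHandlebody.lean` (`IsLefschetzHandlebody g l X`, `ModelsOn M g l` on the concrete base
`Base g ⊂ ℂ²`) and the signed-word calculus of
`Literature/GroupTheory/CombinatorialGroupTheory/SignedHurwitz{Action,Stabilisation}.lean`
(`letters`, `ratWord`, `wordProduct`, `stdSymp`, `Reach`).  Consumers: crux
`ConvexBisection.AcyclicBisectionExists` (stmt-SmoothPoincare4-10508), line `modp-braid-orbits`,
whose one open stub `stub_sortedModelOfHandleSplitting` is their composition with the Stein
realisation fact `Literature.Geometry.Symplectic.steinRealisation_of_sorted_modelsOnFibred`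
(`LefschetzSteinRealisation.lean`).

Throughout, a FIBRED MODEL `ModelsOnFibred M g l` of the closed 4-manifold `M` is a presentation
`M = X ∪_Ψ Base g` with `X = X(F_{g,1}; l)` the (achiral) Lefschetz handlebody of the signed word
`l` (letters = classes of the vanishing cycles in `H₁(F_{g,1}; ℤ) = ℤ^{2g}` in the symplectic
coordinates of the `A_{2g}` chain, sign = chirality) and `Ψ : ∂X ≅ ∂(F × D²)` page-preserving on the
unsurgered seam — so that `M ∖ (S¹ × D³)` is an achiral Lefschetz fibration over `S²` with fibre
`F_{g,1}` and Hurwitz word `l` (Etnyre–Fuller 2006, proof of Thm. 1, p. 8); the weaker ONE-SIDED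
HANDLEBODY MODEL `ModelsOn M g l` allows any `Ψ` (same manifold by Laudenbach–Poénaru, but the word
need not close up to a fibration); see the module docstring of `LefschetzHandlebody.lean`.  Facts
whose printed proofs use the closed-up fibration (1, 3, 4) are stated over `ModelsOnFibred`; fact 2
holds for the weak model.

1. `modelsOnFibred_exists` — **Etnyre–Fuller 2006, Thm. 1 with Prop. 12 and §2; Baykur 2006,
   Lemma 1.**  Every closed connected oriented smooth 4-manifold has a fibred model all of whose
   classes are non-zero.  EF Thm. 1 (p. 2): *"Let `X` be a smooth, closed, oriented 4-manifold. Then there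
   exists a framed circle in `X` such that the manifold obtained by surgery along that circle admits
   an achiral Lefschetz fibration with base `S²`"*, proved (p. 8) in the form *"`X = W ∪ S¹ × D³`"*
   with `W → S²` achiral Lefschetz with bounded fibres of connected boundary (Prop. 12: two
   2-handlebodies with achiral Lefschetz fibrations over `D²` of the same genus and coinciding
   boundary open books, glued along the pages); §2 (p. 4): *"The manifold `X` is obtained from
   `Σ × D²` by attaching 2-handles along the `γ_{p_i}`'s with framing one less than the framing
   induced by `Σ`"* (one more for negative critical points).  Baykur Lemma 1 (p. 12): the fibrations
   can be taken ALLOWABLE (*"one can always build an achiral Lefschetz fibration on a given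
   2-handlebody so that all vanishing cycles are non-separating … all vanishing cycles introduced
   during stabilizations are also nonseparating"*); on `F_{g,1}` non-separating = homologically
   non-zero.
2. `modelsOn_counts_of_homotopyEquiv_sphere` — **homology bookkeeping of a model of a homotopy
   4-sphere** (Gompf–Stipsicz 1999, §8.2: `H₁(X(F; l); ℤ) = H₁(F)/⟨[γᵢ]⟩`, `χ(X) = χ(F) + n`; EF §2:
   `∂X ∖ B` is the `F`-bundle over `S¹` with monodromy `∏ D_{γᵢ}^{±1}`, acting on `H₁(F)` by the
   product of the signed Picard–Lefschetz transvections).  If `M ≃ S⁴` then: `χ(M) = 2 = (1 − 2g + n)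
   + (1 − 2g)` gives `n = 4g` letters; `H₁(X; ℤ) = H₁(M; ℤ) = 0` (3- and 4-handles do not change
   `H₁`) gives classes spanning `ℤ^{2g}`; and `H₁(∂X; ℤ) ≅ H₁(#^{2g} S¹ × S²) = ℤ^{2g} =
   coker(μ_* − 1)` forces trivial homological monodromy `μ_* = wordProduct l = 1`.
3. `modelsOnFibred_balance_of_homotopyEquiv_sphere` — **the chirality balance** `#positive = 2g`
   for a FIBRED model of a homotopy 4-sphere: Etnyre–Fuller 2006, eq. (d3) p. 7 (for the contact
   structure supported by the boundary open book of an achiral Lefschetz fibration `X → D²` with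
   `c₁(ξ) = 0`, `d₃(ξ) = ¼(c²(X) − 3σ(X) − 2χ(X)) + q`, `q` = number of negative vanishing cycles;
   from Gompf 1998, Thm. 4.12 / Ding–Geiges–Stipsicz 2004) applied to the two sides `X(F; l)` and
   `−(cap) ≅ F × D²` of the closed-up fibration, which induce the SAME open book on the seam
   `H = ∂X = ∂(−cap)` (this is where fibredness is used; a weak model does not suffice): `c₁(ξ) = 0`
   and `c² = 0` from the `F × D²` side (`H² = 0`), `c²(X) = 0` and `σ(X) = 0` because `H₂(M; ℚ) = 0`
   makes the intersection form of the codimension-0 piece `X` vanish, `χ(X) = 1 + 2g`,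
   `χ(F × D²) = 1 − 2g`: `−(1 + 2g)/2 + q = −(1 − 2g)/2 + 0`, i.e. `q = 2g` negative and hence `2g`
   positive letters.  (A corollary of the printed formula for the honest fibration over `S²`;
   recorded as a separate fact with that derivation.)
4. `modelsOnFibred_of_reach` — **invariance of fibred models under the signed calculus**
   (`Reach` = signed Hurwitz moves + stabilisation-pair moves): Gompf–Stipsicz 1999, §8.2 and
   Baykur 2006, p. 13 (a Hurwitz move — re-choice of the arc system, "conjugated arcs" — changes the
   word by the signed Picard–Lefschetz transvection and the handlebody by handle slides, not the
   manifold); Etnyre–Fuller 2006, §2 p. 5 (*"stabilizing results in an achiral Lefschetz fibration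
   of the same 4-manifold"*) with Baykur 2006, Lemma 1 (stabilisations in ADJACENT PAIRS keep the
   binding connected; performed on both sides of the cut `l = A ++ B` of the closed-up fibration they
   insert the block `(e + c, +)(f, +)(f, −)(e + c, −)`, `c` the class dual to the stabilising arc, in
   a symplectic basis extended by the new pair `(e, f)` — the algebraic `StabStep` of
   `SignedHurwitzStabilisation.lean`).
5. `isLefschetzHandlebody_homology` — **homology of a Lefschetz handlebody** (Gompf–Stipsicz 1999,
   §8.2; Kas 1980): `X(F_{g,1}; l)` is connected, `H₁(X; ℤ) ≅ ℤ^{2g}/⟨classes⟩`, and (the case used)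
   if the `n = 2g` classes span `ℚ^{2g}` then `X` is ℚ-acyclic in positive degrees
   (`H₂ ≅ ker(ℤⁿ → ℤ^{2g})`, no 3-, 4-handles).  `-- TODO(general form)` below.

Conventions (fixed once, with derivations, in the module docstring of `LefschetzBasePages.lean`,
"Conventions (a)–(c)"): letters are attached CLOCKWISE in the page angle (so that, by
Akbulut–Ozbagci 2001 §2.3, the global monodromy is `wordProduct l`, first letter outermost); a
positive letter is a handle of page twisting `−1` (Etnyre–Fuller §2, in the positive frame
`(K', iK', n)` of the boundary of the complex domain); shadows are read through `shadowMap` (the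
`A_{2g}` chain `chainLoop` ↦ `chainVec`, a `+1`-chain for the complex orientation of the page, so
that the intersection form goes to `stdSymp` and Picard–Lefschetz `(t_a)_* b = b + (a · b) a`,
Farb–Margalit Prop. 6.3, reads as `transvection`).  The facts below are true for exactly one of the
two values of the product of these three signs; a global sign error would replace each of them by
its mirror statement — the audit targets are (a)–(c) there.

## References
* J. B. Etnyre, T. Fuller, *Realizing 4-manifolds as achiral Lefschetz fibrations*, IMRN 2006
  (arXiv:math/0510008): Thm. 1, Prop. 12, §2, eq. (d3). [EtnyreFuller2006]
* R. İ. Baykur, *Kähler decomposition of 4-manifolds*, Algebr. Geom. Topol. 6 (2006) 1239–1265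
  (arXiv:math/0601396): Lemma 1, §5 pp. 12–14. [Baykur2006]
* R. E. Gompf, A. I. Stipsicz, *4-Manifolds and Kirby Calculus*, GSM 20 (1999), §4.4, §8.2.
  [GompfStipsicz1999]
* R. E. Gompf, *Handlebody construction of Stein surfaces*, Ann. of Math. 148 (1998), §4.
  [Gompf1998]
* A. Kas, *On the handlebody decomposition associated to a Lefschetz fibration*, Pacific J. Math.
  89 (1980). [Kas1980]
* F. Laudenbach, V. Poénaru, *A note on 4-dimensional handlebodies*, BSMF 100 (1972).
-/

noncomputable section

open scoped Manifold ContDiff Topology ContinuousMap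
open Set Function
open Literature.GroupTheory.CombinatorialGroupTheory.SignedHurwitz
open Literature.AlgebraicTopology.SingularHomology

namespace Literature.Topology.FourManifolds

/-- Local notation: `𝔼 n` is the model Euclidean space `EuclideanSpace ℝ (Fin n)`. -/
local notation "𝔼 " n:arg => EuclideanSpace ℝ (Fin n)
/-- Local notation: the round 4-sphere. -/
local notation "𝕊⁴" => (Metric.sphere (0 : EuclideanSpace ℝ (Fin 5)) 1)

namespace LefschetzBase

/-- **Etnyre–Fuller 2006 (Thm. 1 with Prop. 12 and §2), with Baykur 2006, Lemma 1: every closed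
connected oriented smooth 4-manifold has an allowable fibred Lefschetz model.**  For every
compact connected orientable `C^∞` 4-manifold `M` without boundary there are `g` and a signed word
`l` on `ℤ^{2g}` with all classes non-zero (allowable: non-separating vanishing cycles) such that
`ModelsOnFibred M g l` — `M = X(F_{g,1}; l) ∪_Ψ (F_{g,1} × D²)` glued page-preservingly, i.e.
`M ∖ S¹ × D³` is an achiral Lefschetz fibration over `S²` with bounded fibres of connected boundary
(EF, proof of Thm. 1, p. 8: "`X = W ∪ S¹ × D³`"). [cite: EtnyreFuller2006, Thm. 1 and Prop. 12] -/
def modelsOnFibred_exists : Prop :=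
  ∀ (M : Type) [TopologicalSpace M] [T2Space M] [SecondCountableTopology M] [CompactSpace M]
    [ConnectedSpace M] [ChartedSpace (𝔼 4) M] [IsManifold (𝓡 4) ∞ M],
    IsOrientable (𝓡 4) M →
    ∃ (g : ℕ) (l : List ((Fin g ⊕ Fin g → ℤ) × Bool)), (∀ x ∈ l, x.1 ≠ 0) ∧ ModelsOnFibred M g l

/-- **Counts of a one-sided model of a homotopy 4-sphere** (Gompf–Stipsicz 1999, §8.2;
Etnyre–Fuller 2006, §2): if `M ≃ S⁴` is modelled by `(g, l)` (the weak handlebody model suffices: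
only `X`, `H_*(M)` and `∂X ≅ #^{2g} S¹ × S²` enter) then `l` has `4g` letters (`χ(M) = 2`), its
classes span `ℚ^{2g}` (`H₁(X; ℤ) = H₁(M; ℤ) = 0`), and its signed homological monodromy is trivial
(`H₁(∂X) = ℤ^{2g} = coker(μ_* − 1)`). [cite: GompfStipsicz1999, §8.2] -/
def modelsOn_counts_of_homotopyEquiv_sphere : Prop :=
  ∀ (M : Type) [TopologicalSpace M] [T2Space M] [SecondCountableTopology M]
    [ChartedSpace (𝔼 4) M] [IsManifold (𝓡 4) ∞ M] (g : ℕ) (l : List ((Fin g ⊕ Fin g → ℤ) × Bool)),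
    M ≃ₕ 𝕊⁴ → ModelsOn M g l →
    l.length = 4 * g ∧ Submodule.span ℚ (letters (ratWord l)) = ⊤ ∧ wordProduct (stdSymp ℤ g) l = 1

/-- **Chirality balance of a fibred model of a homotopy 4-sphere** (corollary of Etnyre–Fuller
2006, eq. (d3), p. 7 — `d₃(ξ) = ¼(c²(X) − 3σ(X) − 2χ(X)) + q` for the boundary open book of an
achiral Lefschetz fibration with `q` negative vanishing cycles and `c₁(ξ) = 0` — applied to the two
fillings `X(F; l)`, `−cap ≅ F × D²` of the common seam open book of the closed-up fibration over
`S²`, where `c₁ = 0`, `c² = 0`, `σ = 0` because `H₂(M; ℚ) = 0`, `χ = 1 ± 2g`): exactly `2g` of the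
letters are positive.  Stated for FIBRED models only (for a weak model the seam open books need not
match and `c₁(ξ)` need not vanish). [cite: EtnyreFuller2006, eq. (d3) p. 7] -/
def modelsOnFibred_balance_of_homotopyEquiv_sphere : Prop :=
  ∀ (M : Type) [TopologicalSpace M] [T2Space M] [SecondCountableTopology M]
    [ChartedSpace (𝔼 4) M] [IsManifold (𝓡 4) ∞ M] (g : ℕ) (l : List ((Fin g ⊕ Fin g → ℤ) × Bool)),
    M ≃ₕ 𝕊⁴ → ModelsOnFibred M g l → (l.filter (·.2)).length = 2 * g

/-- **Fibred models are invariant under the signed Hurwitz / stabilisation-pair calculus**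
(Gompf–Stipsicz 1999, §8.2 and Baykur 2006, p. 13: Hurwitz moves re-choose the arcs of the SAME
fibration and slide handles; Etnyre–Fuller 2006, §2 with Baykur 2006, Lemma 1: an adjacent pair of
stabilisations on both sides of any cut of the closed-up fibration presents the same manifold as a
new fibration over `S²` and inserts the block of `StabStep`): if `M` is fibred-modelled by `(g, l)`
and `(g', l')` is reachable from `(g, l)`, then `M` is fibred-modelled by `(g', l')`.
[cite: Baykur2006, Lemma 1 and §5 p. 13] -/
def modelsOnFibred_of_reach : Prop :=
  ∀ (M : Type) [TopologicalSpace M] [T2Space M] [SecondCountableTopology M]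
    [ChartedSpace (𝔼 4) M] [IsManifold (𝓡 4) ∞ M] (g : ℕ) (l : IntWord g) (g' : ℕ) (l' : IntWord g'),
    ModelsOnFibred M g l → Reach g l g' l' → ModelsOnFibred M g' l'

/-- **Homology of a Lefschetz handlebody** (Gompf–Stipsicz 1999, §8.2; Kas 1980): `X = X(F_{g,1}; l)`
is connected, `H₁(X; ℤ) ≅ ℤ^{2g}/⟨classes of l⟩`, and if `l` has `2g` letters whose classes span
`ℚ^{2g}` then `H_k(X; ℚ) = 0` for all `k > 0` (`H₂ ≅ ker(ℤ^{2g} → ℤ^{2g}) ⊗ ℚ = 0`, no handles of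
index `≥ 3`). [cite: GompfStipsicz1999, §8.2] -/
def isLefschetzHandlebody_homology : Prop :=
  ∀ (g : ℕ) (l : List ((Fin g ⊕ Fin g → ℤ) × Bool)) (X : Type) [TopologicalSpace X] [T2Space X]
    [SecondCountableTopology X] [CompactSpace X] [ChartedSpace (EuclideanHalfSpace 4) X]
    [IsManifold (𝓡∂ 4) ∞ X],
    IsLefschetzHandlebody g l X →
    ConnectedSpace X ∧
      Nonempty ((singularHomology ℤ ℤ X 1) ≃ₗ[ℤ]
        ((Fin g ⊕ Fin g → ℤ) ⧸ Submodule.span ℤ (letters l))) ∧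
      (Submodule.span ℚ (letters (ratWord l)) = ⊤ → l.length = 2 * g →
        ∀ k, 0 < k → CategoryTheory.Limits.IsZero (singularHomology ℚ ℚ X k))
-- TODO(general form): Gompf–Stipsicz 1999, §8.2 computes all of `H_*(X(F; l); ℤ)`:
-- `H₂ ≅ ker(ℤⁿ → H₁(F))`, `H₁ ≅ coker`, `H_k = 0` for `k ≥ 3`, for any number `n` of letters.

/-- **Milnor 1968, Thm. 9.1 (with Lemma 9.4) for the `A_{2g}` curve: the homology shadow exists.**
`H₁` of the Milnor fibre `{y² = x^{2g+1} + 1}` (and of the base `Base g`, which retracts onto its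
part over `‖x‖ ≤ 2`) is free of rank `μ = 2g` on the distinguished chain of vanishing cycles, so a
linear bijection `H₁(Base g; ℤ) → ℤ^{2g}` with the prescribed values on the chain loops exists
(`IsChainShadow`); this is what makes `shadowMap g` (chosen by `Classical.epsilon`) the intended
identification.  Not on the composition path of the crux (the facts above are stated through
`shadow`), recorded as the standing hypothesis of their dictionary. [cite: Milnor1968, Thm. 9.1] -/
def exists_isChainShadow : Prop :=
  ∀ g : ℕ, ∃ σ, IsChainShadow g σ

end LefschetzBase

end Literature.Topology.FourManifolds
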